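import Summits.CriticalPhenomena.PercolationContinuityZ3.Theorems.PercNearOneGluingNoHeavyQuantCornerStep
import Summits.CriticalPhenomena.PercolationContinuityZ3.Theorems.PercNearOneGluingNoHeavyQuantCornerSound
import Summits.CriticalPhenomena.PercolationContinuityZ3.Theorems.PercNearOneGluingNoHeavyQuantLawDecFlowsDecomposition
import HarnessLib

/-!
# QUANT lane R8, T-DEC: the CORNER THEOREM, part 2 — COMPLETENESS of the corner certificate; `LawDec.CornerTheorem` HOLDS (N45 (2)/(4))

builds on p205010 (kernel theorem, internal audit signed; external expert review pending)

Support file (`--supports stmt-CriticalPhenomena-4575`), QUANT lane typer seat prim-quant-stmt (gen 23), rung R8 of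
`run/shared/lean/prim/quant/LADDER.md`.  Theorems only; standard axioms, no sorries.  Continues `…QuantCornerStep` (the corner step over
`FlowAtT`) and `…QuantCornerSound` (invariants, soundness).

* `cornerPair_of_index`, `cornerIndex_lt_of_lt`, `cornerFlow_col_low` (no low is loaded), `cornerFlow_row_mid` (no absorber ships).
* **`cornerResidual_flowAtT`** — along the run the RESIDUAL instances `cornerResidual (cornerFlow n)` stay feasible and every processed
  admissible pair has exhausted its low or saturated its mid: induction on `n`; the step is `FlowAtT.corner_step` (lead N45 (4) CLAIM, with
  `hhigh`/`hbelow` supplied by the invariant) followed by `IsFlowAtT.residual`; when the low is already exhausted nothing is shipped.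
* **`cornerSucceeds_of_flowAtT`** — COMPLETENESS: after the run a witness of the final residual instance ships every leftover through the
  giants (a mid compatible with a low that still has mass is saturated), whose residual capacity is their mass and whose usage is `x/(1−x)`:
  `x/(1−x)·Σ leftover ≤ Σ_giants μ`.
* **`cornerTheorem_holds : CornerTheorem`**, `flowAtT_iff_cornerSucceeds`, **`decAtT_iff_cornerSucceeds`** (probability laws) — for `0 < x < 1` and a nonnegative law,
  `FlowAtT x T j′ M μ ↔ CornerSucceeds x T j′ M μ`: DEC(j′) (`decAtT_iff_flowAtT`, typer g22) has a CANONICAL witness and is decided by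
  the corner run — `(j′+1)²` closed-form steps, no LP (lead g21's corner rule; exact censuses kit j135057: 1 675 179 / 0 and 1 182 569 / 0).

[this work]; `…QuantLawDecFlows(Decomposition)` (typer g22), `…QuantLawDecUsageMonge(Rates)` (lead g21), `…QuantFlowUncross/CornerPrelims/
CornerStep/CornerRun/CornerSound` (this seat).  Corner rules / Monge arrays are classical (Hoffman 1963); nothing here is cited as a
published result.  The gluing rows served [cite: KozmaNitzan2024, Conjecture 3 (p. 15)]; product measure [cite: Grimmett1999, §1.3 p. 10].
-/

noncomputable section

namespace Summit.CriticalPhenomena.PercolationContinuityZ3.Theorems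

namespace Quant

open Finset

namespace LawDec

/-! ### Completeness: a feasible instance passes the corner run -/

/-- the pair with stage index `n` IS the pair of stage `n`. -/
theorem cornerPair_of_index (j' l h n : ℕ) (hl : l ≤ j') (hh : h ≤ j') (hn : (j' - l) * (j' + 1) + h = n) :
    cornerPair j' n = (l, h) := by
  subst hn
  unfold cornerPair
  rw [Nat.add_comm, Nat.add_mul_div_right _ _ (Nat.succ_pos j'), Nat.div_eq_of_lt (by omega), zero_add,
    Nat.add_mul_mod_self_right, Nat.mod_eq_of_lt (by omega), Nat.sub_sub_self hl]

/-- a higher low is processed earlier. -/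
theorem cornerIndex_lt_of_lt (j' l l'' h h'' : ℕ) (hl : l < l'') (hl'' : l'' ≤ j') (hh'' : h'' ≤ j') :
    (j' - l'') * (j' + 1) + h'' < (j' - l) * (j' + 1) + h := by
  have h1 := Nat.mul_le_mul_right (j' + 1) (show j' - l'' + 1 ≤ j' - l by omega)
  rw [Nat.add_mul, one_mul] at h1
  omega

/-- in the corner flow no low is loaded: `Σ_{l'} usage(l',l)·F l' l = 0` for a low `l`. -/
theorem cornerFlow_col_low (x T : ℝ) (j' M : ℕ) (μ : ℕ → ℝ) (hx0 : 0 < x) (hx1 : x < 1) (hμ : ∀ k, 0 ≤ μ k)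
    (n : ℕ) (hn : n ≤ (j' + 1) * (j' + 1)) (l : ℕ) (hlow : 2 * (l : ℝ) < T) :
    ∑ l' ∈ Finset.range (j' + 1), usage x T j' l' l * cornerFlow x T j' M μ n l' l = 0 := by
  obtain ⟨-, hsup, -, -⟩ := cornerFlow_inv x T j' M μ hx0 hx1 hμ n hn
  refine Finset.sum_eq_zero (fun l' _ => ?_)
  by_cases hF : cornerFlow x T j' M μ n l' l = 0
  · rw [hF, mul_zero]
  · obtain ⟨-, -, h3, -, h5, -⟩ := hsup l' l hF
    linarith

/-- in the corner flow no absorber ships: `Σ_{h'} F h h' = 0` when `T < l + h` for a low `l`. -/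
theorem cornerFlow_row_mid (x T : ℝ) (j' M : ℕ) (μ : ℕ → ℝ) (hx0 : 0 < x) (hx1 : x < 1) (hμ : ∀ k, 0 ≤ μ k)
    (n : ℕ) (hn : n ≤ (j' + 1) * (j' + 1)) (l h : ℕ) (hlow : 2 * (l : ℝ) < T) (hcomp : T < (l : ℝ) + h) :
    ∑ h' ∈ Finset.range (M + 1), cornerFlow x T j' M μ n h h' = 0 := by
  obtain ⟨-, hsup, -, -⟩ := cornerFlow_inv x T j' M μ hx0 hx1 hμ n hn
  refine Finset.sum_eq_zero (fun h' _ => ?_)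
  by_cases hF : cornerFlow x T j' M μ n h h' = 0
  · exact hF
  · obtain ⟨-, -, h3, -, -, -⟩ := hsup h h' hF
    linarith

/-- **THE RESIDUAL INSTANCES OF THE CORNER RUN STAY FEASIBLE** (`0 < x < 1`, nonnegative law, `FlowAtT μ`): for every stage
`n ≤ (j′+1)²`, `FlowAtT (cornerResidual (cornerFlow n))`, and every processed admissible pair has exhausted its low or saturated its mid.
The step is the corner step `FlowAtT.corner_step` (…QuantCornerStep) followed by `IsFlowAtT.residual`. [this work] -/
theorem cornerResidual_flowAtT (x T : ℝ) (j' M : ℕ) (μ : ℕ → ℝ) (hx0 : 0 < x) (hx1 : x < 1) (hμ : ∀ k, 0 ≤ μ k)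
    (hF : FlowAtT x T j' M μ) :
    ∀ n : ℕ, n ≤ (j' + 1) * (j' + 1) →
      FlowAtT x T j' M (cornerResidual x T j' M μ (cornerFlow x T j' M μ n)) ∧
      (∀ l h, l ≤ j' → h ≤ j' → 2 * (l : ℝ) < T → h ≤ M → T < (l : ℝ) + h → (j' - l) * (j' + 1) + h < n →
        cornerResidual x T j' M μ (cornerFlow x T j' M μ n) l = 0 ∨
          cornerResidual x T j' M μ (cornerFlow x T j' M μ n) h = 0) := by
  intro n
  induction n with
  | zero =>
    intro _
    refine ⟨?_, fun l h _ _ _ _ _ hlt => absurd hlt (Nat.not_lt_zero _)⟩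
    have : cornerResidual x T j' M μ (cornerFlow x T j' M μ 0) = μ := by
      funext k; rw [cornerFlow_zero]; exact cornerResidual_zero x T j' M μ k
    rw [this]; exact hF
  | succ n ih =>
    intro hn
    obtain ⟨hfeas, hzero⟩ := ih (by omega)
    obtain ⟨h0, hsup, hrow, hcol⟩ := cornerFlow_inv x T j' M μ hx0 hx1 hμ n (by omega)
    -- the pair of stage n
    obtain ⟨l, hh, hp⟩ : ∃ l h : ℕ, cornerPair j' n = (l, h) := ⟨_, _, rfl⟩
    have hlj : l ≤ j' := by have := cornerPair_fst_le j' n; rw [hp] at this; exact this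
    have hhj : hh ≤ j' := by have := cornerPair_snd_le j' n; rw [hp] at this; exact this
    have hidx : (j' - l) * (j' + 1) + hh = n := by have := cornerPair_index j' n (by omega); rw [hp] at this; exact this
    -- a processed pair of stage < n+1 is either older or the pair of stage n
    have holder : ∀ l' h', l' ≤ j' → h' ≤ j' → (j' - l') * (j' + 1) + h' < n + 1 →
        (j' - l') * (j' + 1) + h' < n ∨ (l' = l ∧ h' = hh) := by
      intro l' h' hl' hh' hlt
      rcases Nat.lt_succ_iff_lt_or_eq.1 hlt with hlt | heq
      · exact Or.inl hlt
      · right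
        have := cornerPair_of_index j' l' h' n hl' hh' heq
        rw [hp] at this
        exact ⟨(Prod.mk.inj this).1.symm, (Prod.mk.inj this).2.symm⟩
    rw [cornerFlow_succ, hp]
    by_cases hadm : 2 * (l : ℝ) < T ∧ hh ≤ M ∧ T < (l : ℝ) + hh
    · obtain ⟨hlow, hhM, hcomp⟩ := hadm
      have hF0 : cornerFlow x T j' M μ n l hh = 0 := by
        by_contra hne
        have := (hsup l hh hne).2.2.2.2.2
        omega
      have hlh : l < hh := by
        by_contra hge
        push Not at hge
        have : (hh : ℝ) ≤ l := by exact_mod_cast hge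
        linarith
      have hu : 0 < usage x T j' l hh := usage_pos_of_compat x T j' l hh hx0 hx1 hlow hlh (Or.inr hcomp)
      rw [cornerUpdate_eq_add x T j' M μ _ l hh hF0 hlow hhM hcomp]
      -- the shipped amount is min(residual mass, residual capacity / usage)
      have hVl := cornerFlow_col_low x T j' M μ hx0 hx1 hμ n (by omega) l hlow
      have hVh := cornerFlow_row_mid x T j' M μ hx0 hx1 hμ n (by omega) l hh hlow hcomp
      have hνl : cornerResidual x T j' M μ (cornerFlow x T j' M μ n) l
          = μ l - ∑ h' ∈ Finset.range (M + 1), cornerFlow x T j' M μ n l h' := by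
        unfold cornerResidual; rw [hVl]; ring
      have hνh : cornerResidual x T j' M μ (cornerFlow x T j' M μ n) hh
          = μ hh - ∑ l' ∈ Finset.range (j' + 1), usage x T j' l' hh * cornerFlow x T j' M μ n l' hh := by
        unfold cornerResidual; rw [hVh]; ring
      rw [← hνl, ← hνh]
      generalize hν : cornerResidual x T j' M μ (cornerFlow x T j' M μ n) = ν at hfeas hzero hνl hνh ⊢
      generalize ht : min (ν l) (ν hh / usage x T j' l hh) = t
      have hνl0 : 0 ≤ ν l := by rw [hνl]; linarith [hrow l]
      have hνh0 : 0 ≤ ν hh := by rw [hνh]; linarith [hcol hh]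
      have ht1 : t ≤ ν l := ht ▸ min_le_left _ _
      have ht2 : usage x T j' l hh * t ≤ ν hh := by
        have h2 : t ≤ ν hh / usage x T j' l hh := ht ▸ min_le_right _ _
        rwa [le_div_iff₀ hu, mul_comm] at h2
      have ht0 : 0 ≤ t := by rw [← ht]; exact le_min hνl0 (div_nonneg hνh0 hu.le)
      -- the new residual instance
      have hres : cornerResidual x T j' M μ (fun a b => cornerFlow x T j' M μ n a b
            + t * (if a = l then (1:ℝ) else 0) * (if b = hh then (1:ℝ) else 0))
          = fun k => ν k - t * (if k = l then (1:ℝ) else 0) - usage x T j' l hh * t * (if k = hh then (1:ℝ) else 0) := by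
        funext k
        rw [cornerResidual_update x T j' M μ _ l hh hlj hhM t k, hν]
        by_cases hk : k = hh
        · rw [hk, if_pos rfl]
        · rw [if_neg hk]; ring
      rw [hres]
      -- zeros persist, and the new pair is exhausted or saturated
      have hpersist : ∀ k, ν k = 0 →
          ν k - t * (if k = l then (1:ℝ) else 0) - usage x T j' l hh * t * (if k = hh then (1:ℝ) else 0) = 0 := by
        intro k hk
        by_cases hkl : k = l
        · rw [hkl] at hk ⊢
          rw [if_pos rfl, if_neg (by omega : l ≠ hh)]
          have : t = 0 := le_antisymm (by linarith) ht0
          rw [this, hk]; ring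
        · by_cases hkh : k = hh
          · rw [hkh] at hk ⊢
            rw [if_pos rfl, if_neg (by omega : hh ≠ l)]
            have : usage x T j' l hh * t = 0 := le_antisymm (by linarith) (mul_nonneg hu.le ht0)
            linarith
          · rw [if_neg hkl, if_neg hkh, hk]; ring
      have hnew : ν l - t * (if l = l then (1:ℝ) else 0) - usage x T j' l hh * t * (if l = hh then (1:ℝ) else 0) = 0 ∨
          ν hh - t * (if hh = l then (1:ℝ) else 0) - usage x T j' l hh * t * (if hh = hh then (1:ℝ) else 0) = 0 := by
        rw [if_pos rfl, if_neg (by omega : l ≠ hh), if_neg (by omega : hh ≠ l), if_pos rfl]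
        rcases min_choice (ν l) (ν hh / usage x T j' l hh) with h1 | h2
        · left; rw [← ht, h1]; ring
        · right; rw [← ht, h2]; field_simp; ring
      refine ⟨?_, ?_⟩
      · -- feasibility of the new residual instance
        by_cases hνl00 : ν l = 0
        · -- nothing is shipped
          have ht00 : t = 0 := le_antisymm (by linarith) ht0
          have : (fun k => ν k - t * (if k = l then (1:ℝ) else 0) - usage x T j' l hh * t * (if k = hh then (1:ℝ) else 0))
              = ν := by
            funext k; rw [ht00]; ring
          rw [this]; exact hfeas
        · -- the corner step on the residual instance, then zero the corner entry
          have hhigh : ∀ l'' h'' : ℕ, l < l'' → l'' ≤ j' → 2 * (l'' : ℝ) < T → h'' ≤ j' → h'' ≤ M →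
              T < (l'' : ℝ) + h'' → ν l'' = 0 ∨ ν h'' = 0 := by
            intro l'' h'' hll hl'' hlow'' hh'' hhM'' hcomp''
            exact hzero l'' h'' hl'' hh'' hlow'' hhM'' hcomp''
              (by have := cornerIndex_lt_of_lt j' l l'' hh h'' hll hl'' hh''; omega)
          have hbelow : ∀ h'' : ℕ, h'' < hh → h'' ≤ M → T < (l : ℝ) + h'' → ν h'' = 0 := by
            intro h'' hlt hhM'' hcomp''
            rcases hzero l h'' hlj (by omega) hlow hhM'' hcomp'' (by omega) with h1 | h2
            · exact absurd h1 hνl00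
            · exact h2
          obtain ⟨g, hg, hgval⟩ := FlowAtT.corner_step hfeas hx0 hx1 l hh hlj hlow hhigh hhj hhM hcomp hbelow
          rw [ht] at hgval
          have hres' := hg.residual l hh hlj hlow hhM hcomp
          rw [hgval] at hres'
          exact ⟨_, hres'⟩
      · intro l' h' hl' hh' hlow' hhM' hcomp' hlt
        rcases holder l' h' hl' hh' hlt with hold | ⟨rfl, rfl⟩
        · rcases hzero l' h' hl' hh' hlow' hhM' hcomp' hold with h1 | h2
          · exact Or.inl (hpersist l' h1)
          · exact Or.inr (hpersist h' h2)
        · exact hnew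
    · rw [cornerUpdate_of_not_admissible x T j' M μ _ (l, hh) hadm]
      refine ⟨hfeas, fun l' h' hl' hh' hlow' hhM' hcomp' hlt => ?_⟩
      rcases holder l' h' hl' hh' hlt with hold | ⟨rfl, rfl⟩
      · exact hzero l' h' hl' hh' hlow' hhM' hcomp' hold
      · exact absurd ⟨hlow', hhM', hcomp'⟩ hadm

/-- **COMPLETENESS OF THE CORNER CERTIFICATE** (`FlowAtT → CornerSucceeds`; `0 < x < 1`, nonnegative law): after the run every low with
a leftover meets only saturated mids, so a witness of the final residual instance ships all leftovers through the giants at rate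
`x/(1−x)`. [this work] -/
theorem cornerSucceeds_of_flowAtT (x T : ℝ) (j' M : ℕ) (μ : ℕ → ℝ) (hx0 : 0 < x) (hx1 : x < 1) (hμ : ∀ k, 0 ≤ μ k)
    (hF : FlowAtT x T j' M μ) : CornerSucceeds x T j' M μ := by
  obtain ⟨hfeas, hzero⟩ := cornerResidual_flowAtT x T j' M μ hx0 hx1 hμ hF ((j' + 1) * (j' + 1)) le_rfl
  obtain ⟨-, hsup, -, -⟩ := cornerFlow_inv x T j' M μ hx0 hx1 hμ ((j' + 1) * (j' + 1)) le_rfl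
  obtain ⟨g, hg0, hgsupp, hgrow, hgcol⟩ := hfeas
  unfold CornerSucceeds
  have h1x : 0 < 1 - x := by linarith
  have hxr : 0 < x / (1 - x) := div_pos hx0 h1x
  -- every admissible pair has been processed
  have hproc : ∀ l h, l ≤ j' → h ≤ j' → (j' - l) * (j' + 1) + h < (j' + 1) * (j' + 1) := by
    intro l h hl hh
    have h1 := Nat.mul_le_mul_right (j' + 1) (show j' - l + 1 ≤ j' + 1 by omega)
    rw [Nat.add_mul, one_mul] at h1
    omega
  -- the leftover of a low is its residual mass, and a witness ships it entirely through the giants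
  have hleft : ∀ l, l ≤ j' → 2 * (l : ℝ) < T →
      cornerLeftover x T j' M μ l = ∑ h ∈ Finset.range (M + 1), (if j' + 1 ≤ h then g l h else 0) := by
    intro l hlj hlow
    have hν : cornerResidual x T j' M μ (cornerMidFlow x T j' M μ) l = cornerLeftover x T j' M μ l := by
      unfold cornerResidual cornerLeftover cornerMidFlow
      rw [cornerFlow_col_low x T j' M μ hx0 hx1 hμ _ le_rfl l hlow]; ring
    rw [← hν]
    unfold cornerMidFlow
    rw [← hgrow l hlj hlow]
    refine Finset.sum_congr rfl (fun h hhr => ?_)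
    by_cases hgi : j' + 1 ≤ h
    · rw [if_pos hgi]
    · rw [if_neg hgi]
      -- a mid carries nothing from `l`: it is saturated, or `l` is exhausted
      have hhj : h ≤ j' := by omega
      by_contra hne
      have hpos : 0 < g l h := lt_of_le_of_ne (hg0 l h) (Ne.symm hne)
      obtain ⟨-, -, hhM, hc⟩ := hgsupp l h hpos
      have hcomp : T < (l : ℝ) + h := by
        rcases hc with hc | hc
        · omega
        · exact hc
      rcases hzero l h hlj hhj hlow hhM hcomp (hproc l h hlj hhj) with hz | hz
      · -- `l` exhausted: its row is zero
        have hrow0 := hgrow l hlj hlow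
        rw [hz] at hrow0
        have := Finset.single_le_sum (f := fun h => g l h) (fun h _ => hg0 l h) hhr
        linarith
      · -- `h` saturated: its column is zero
        have hlh : l < h := by
          by_contra hge
          push Not at hge
          have : (h : ℝ) ≤ l := by exact_mod_cast hge
          linarith
        have hu := usage_pos_of_compat x T j' l h hx0 hx1 hlow hlh (Or.inr hcomp)
        have hcol0 := hgcol h hhM (Or.inr (by linarith))
        rw [hz] at hcol0
        have hterm : ∀ l', 0 ≤ usage x T j' l' h * g l' h := by
          intro l'
          rcases (hg0 l' h).lt_or_eq with hp | h0'
          · obtain ⟨-, hlow', -, hc'⟩ := hgsupp l' h hp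
            have hlh' : l' < h := by
              rcases hc' with hc' | hc'
              · omega
              · by_contra hge
                push Not at hge
                have : (h : ℝ) ≤ l' := by exact_mod_cast hge
                linarith
            exact mul_nonneg (usage_pos_of_compat x T j' l' h hx0 hx1 hlow' hlh' hc').le hp.le
          · rw [← h0', mul_zero]
        have := Finset.single_le_sum (f := fun l' => usage x T j' l' h * g l' h) (fun l' _ => hterm l')
          (Finset.mem_range.2 (by omega : l < j' + 1))
        have := mul_pos hu hpos
        linarith
  -- the giants absorb: usage x/(1−x), capacity = residual capacity = mass
  have hgiant : ∀ h, j' + 1 ≤ h → h ≤ M →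
      x / (1 - x) * ∑ l ∈ Finset.range (j' + 1), g l h ≤ μ h := by
    intro h hgi hhM
    have hν : cornerResidual x T j' M μ (cornerMidFlow x T j' M μ) h = μ h := by
      unfold cornerResidual cornerMidFlow
      have hz1 : ∑ h' ∈ Finset.range (M + 1), cornerFlow x T j' M μ ((j' + 1) * (j' + 1)) h h' = 0 := by
        refine Finset.sum_eq_zero (fun h' _ => ?_)
        by_contra hne
        have := (hsup h h' hne).1; omega
      have hz2 : ∑ l ∈ Finset.range (j' + 1), usage x T j' l h * cornerFlow x T j' M μ ((j' + 1) * (j' + 1)) l h = 0 := by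
        refine Finset.sum_eq_zero (fun l _ => ?_)
        by_cases hF0 : cornerFlow x T j' M μ ((j' + 1) * (j' + 1)) l h = 0
        · rw [hF0, mul_zero]
        · have := (hsup l h hF0).2.1; omega
      rw [hz1, hz2]; ring
    have hc := hgcol h hhM (Or.inl hgi)
    unfold cornerMidFlow at hν
    rw [hν] at hc
    rw [Finset.mul_sum]
    refine le_trans (le_of_eq ?_) hc
    exact Finset.sum_congr rfl (fun l _ => by rw [usage_giant_eq x T j' l h hgi])
  -- sum up
  calc x / (1 - x) * ∑ l ∈ (Finset.range (j' + 1)).filter (fun l : ℕ => 2 * (l : ℝ) < T), cornerLeftover x T j' M μ l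
      = x / (1 - x) * ∑ l ∈ (Finset.range (j' + 1)).filter (fun l : ℕ => 2 * (l : ℝ) < T),
          ∑ h ∈ Finset.range (M + 1), (if j' + 1 ≤ h then g l h else 0) := by
        congr 1
        refine Finset.sum_congr rfl (fun l hl => ?_)
        obtain ⟨hlr, hlow⟩ := Finset.mem_filter.1 hl
        exact hleft l (by have := Finset.mem_range.1 hlr; omega) hlow
    _ ≤ x / (1 - x) * ∑ l ∈ Finset.range (j' + 1), ∑ h ∈ Finset.range (M + 1), (if j' + 1 ≤ h then g l h else 0) := by
        refine mul_le_mul_of_nonneg_left ?_ hxr.le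
        refine Finset.sum_le_sum_of_subset_of_nonneg (Finset.filter_subset _ _) (fun l _ _ => ?_)
        exact Finset.sum_nonneg (fun h _ => by split_ifs; exacts [hg0 l h, le_rfl])
    _ = ∑ h ∈ Finset.range (M + 1), (if j' + 1 ≤ h then x / (1 - x) * ∑ l ∈ Finset.range (j' + 1), g l h else 0) := by
        rw [Finset.sum_comm, Finset.mul_sum]
        refine Finset.sum_congr rfl (fun h _ => ?_)
        by_cases hgi : j' + 1 ≤ h
        · simp only [if_pos hgi]
        · simp only [if_neg hgi, Finset.sum_const_zero, mul_zero]
    _ ≤ ∑ h ∈ Finset.range (M + 1), (if j' + 1 ≤ h ∧ h ≤ M then μ h else 0) := by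
        refine Finset.sum_le_sum (fun h hh => ?_)
        have hhM : h ≤ M := by have := Finset.mem_range.1 hh; omega
        by_cases hgi : j' + 1 ≤ h
        · rw [if_pos hgi, if_pos ⟨hgi, hhM⟩]; exact hgiant h hgi hhM
        · rw [if_neg hgi, if_neg (fun hn => hgi hn.1)]
    _ = ∑ h ∈ Finset.Ico (j' + 1) (M + 1), μ h := sum_range_ite_giant j' M μ

/-- **THE CORNER THEOREM HOLDS**: `LawDec.CornerTheorem` (typed in …QuantCornerRun). [this work] -/
theorem cornerTheorem_holds : CornerTheorem := by
  intro x T j' M μ hx0 hx1 hμ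
  exact ⟨cornerSucceeds_of_flowAtT x T j' M μ hx0 hx1 hμ, flowAtT_of_cornerSucceeds x T j' M μ hx0 hx1 hμ⟩

/-- **DEC(j′) at target `T` ⟺ the corner run succeeds**, for nonnegative laws and `0 < x < 1`. [this work] -/
theorem flowAtT_iff_cornerSucceeds (x T : ℝ) (j' M : ℕ) (μ : ℕ → ℝ) (hx0 : 0 < x) (hx1 : x < 1) (hμ : ∀ k, 0 ≤ μ k) :
    FlowAtT x T j' M μ ↔ CornerSucceeds x T j' M μ :=
  cornerTheorem_holds x T j' M μ hx0 hx1 hμ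

/-- **DEC(j′) AT TARGET `T` ⟺ THE CORNER RUN SUCCEEDS**, for probability laws on `{0..M}` and `0 < x < 1` (with typer g22's
`decAtT_iff_flowAtT`): the law-level decomposition property of the QUANT lane is decided by `(j′+1)²` closed-form steps. [this work] -/
theorem decAtT_iff_cornerSucceeds (x T : ℝ) (j' M : ℕ) (μ : ℕ → ℝ) (hx0 : 0 < x) (hx1 : x < 1) (hμ : ∀ k, 0 ≤ μ k)
    (hμM : ∀ h, M < h → μ h = 0) (hμ1 : ∑ h ∈ Finset.range (M + 1), μ h = 1) :
    DECAtT x T j' M μ ↔ CornerSucceeds x T j' M μ :=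
  (decAtT_iff_flowAtT x T j' M μ hx0 hx1 hμM hμ1).trans (flowAtT_iff_cornerSucceeds x T j' M μ hx0 hx1 hμ)

end LawDec

end Quant

end Summit.CriticalPhenomena.PercolationContinuityZ3.Theorems
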